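import Literature.Analysis.FluidPDE.BeltramiFlows
import Literature.Analysis.FluidPDE.NSLerayHopf
import Literature.Claims.NS.Jormakka2010
import Summits.NavierStokesRegularity.NavierStokesRegularity.Theorems.SoloSalvageJormakka2010
import HarnessLib

/-!
# NS-claims map (cell `ns-claims`, D-0090), claim C02 `Jormakka2010`, part 1/2: the datum toolkit

J. Jormakka, *Solutions to three-dimensional Navier–Stokes equations for incompressible fluids*,
EJDE 2010 No. 93 (typed skeleton `Literature.Claims.NS.Jormakka2010`, print locators there). First of
the two files into which ns-claims-refuter-2's kernel checks of that skeleton are split (gate lint: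
Theorems files ≤ 400 lines; filed for the author by the cell's salvage prover under the cell's interim
convention (b), content unchanged). This part: the datum `u⁰` of Lemma 2.1 (p. 2) — Jacobian,
divergence-freeness, strong Beltrami property `curl u⁰ = −2π u⁰`, lattice periodicity, `Δu⁰ = −(2π)²u⁰` —,
the gauge `g(t) = ct²/(2(a−t))` of Theorem 2.3 (p. 4) on `t < a`, the trigonometric phase identity
`key_identity` behind the second closed-loop solution of part 2, and the `g ≡ 0` member of the family
(2.1): exact viscous decay of `u⁰` is a GLOBAL smooth space-periodic solution with periodic pressure, so
the conclusion of Clay (D) fails at the paper's exhibited data unconditionally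
(`not_clayDInstance`, `not_clayDErrataInstance`; kernel support for the «wrong problem» clause of the
verdict — the headline `ClaimedTheorem` does not transfer to `NavierStokesBreakdownPeriodic`).
Part 2 (`SoloRefuteJormakka2010.lean`): the second closed-loop solution and `not_step24UniqueLocal`
(first failing step, p. 5 l. 8–18). Axioms: `propext`, `Classical.choice`, `Quot.sound` only.
WHAT THIS IS NOT: not a claim about NS regularity or blow-up; not a claim about any author beyond the
typed locator.

FILER'S NOTE (ns-claims-salvage-p4, conv. (b), 2026-08-26): to land next to the already-accepted
`Theorems/SoloSalvageJormakka2010.lean` (p464185, same namespace), five declarations with IDENTICAL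
statements there (`contDiffOn_blowupGauge`, `blowupGauge_zero`, `deriv_blowupGauge_zero`,
`not_clayDInstance`, `not_clayDErrataInstance`) were DELETED here and are used from that import, and
the author's `hasDerivAt_blowupGauge` (a different but equivalent derivative expression) was renamed
`hasDerivAt_blowupGauge'`. No statement or proof of the remaining declarations was changed.
-/

-- The summit's canonical theorem namespace repeats the summit name (single-conjunct summit).
set_option linter.dupNamespace false

noncomputable section

open Real Set Function InnerProductSpace
open scoped RealInnerProductSpace ContDiff Laplacian Topology

namespace Summit.NavierStokesRegularity.NavierStokesRegularity.Theorems.Jormakka2010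

open Literature.Analysis.FluidPDE Literature.Claims.NS.Jormakka2010


/-! ### The datum `u⁰` of Lemma 2.1 (p. 2): Jacobian, divergence, strong Beltrami property -/

/-- Jormakka's datum (EJDE 2010/93, Lemma 2.1, p. 2), coordinates `x 0, x 1, x 2` for `x₁, x₂, x₃`:
`u⁰ = 2π (sin 2πx₂ + cos 2πx₃, sin 2πx₃ + cos 2πx₁, sin 2πx₁ + cos 2πx₂)`; equal to the skeleton's
`initialField` (`initialField_eq_datum`). -/
def datum (x : EuclideanSpace ℝ (Fin 3)) : EuclideanSpace ℝ (Fin 3) :=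
  !₂[2 * π * sin (2 * π * x 1) + 2 * π * cos (2 * π * x 2),
     2 * π * sin (2 * π * x 2) + 2 * π * cos (2 * π * x 0),
     2 * π * sin (2 * π * x 0) + 2 * π * cos (2 * π * x 1)]

/-- Component `0` of the datum: `2π (sin 2πx₁ + cos 2πx₂)`. -/
@[simp] theorem datum_apply_zero (x : EuclideanSpace ℝ (Fin 3)) :
    datum x 0 = 2 * π * sin (2 * π * x 1) + 2 * π * cos (2 * π * x 2) := by simp [datum]

/-- Component `1` of the datum: `2π (sin 2πx₂ + cos 2πx₀)`. -/
@[simp] theorem datum_apply_one (x : EuclideanSpace ℝ (Fin 3)) :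
    datum x 1 = 2 * π * sin (2 * π * x 2) + 2 * π * cos (2 * π * x 0) := by simp [datum]

/-- Component `2` of the datum: `2π (sin 2πx₀ + cos 2πx₁)`. -/
@[simp] theorem datum_apply_two (x : EuclideanSpace ℝ (Fin 3)) :
    datum x 2 = 2 * π * sin (2 * π * x 0) + 2 * π * cos (2 * π * x 1) := by simp [datum]

/-- The skeleton's `initialField` (Lemma 2.1, p. 2) is the datum `u⁰` used in this file. -/
theorem initialField_eq_datum : initialField = datum := by
  funext x
  ext i
  fin_cases i <;> simp [initialField, datum] <;> ring

/-- Every component of `𝟙 = (1,1,1)` is `1`. -/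
@[simp] theorem ones_apply (i : Fin 3) : ones i = 1 := by
  fin_cases i <;> simp [ones]

/-- `𝟙 = e₀ + e₁ + e₂`. -/
theorem ones_eq : ones = (EuclideanSpace.single (0 : Fin 3) (1 : ℝ)) + (EuclideanSpace.single (1 : Fin 3) (1 : ℝ)) + (EuclideanSpace.single (2 : Fin 3) (1 : ℝ)) := by
  ext i
  fin_cases i <;> simp [ones]

/-- The datum as a sum of scalar functions times basis vectors. -/
private theorem datum_eq (x : EuclideanSpace ℝ (Fin 3)) :
    datum x = (2 * π * sin (2 * π * x 1) + 2 * π * cos (2 * π * x 2)) • (EuclideanSpace.single (0 : Fin 3) (1 : ℝ)) +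
      (2 * π * sin (2 * π * x 2) + 2 * π * cos (2 * π * x 0)) • (EuclideanSpace.single (1 : Fin 3) (1 : ℝ)) +
      (2 * π * sin (2 * π * x 0) + 2 * π * cos (2 * π * x 1)) • (EuclideanSpace.single (2 : Fin 3) (1 : ℝ)) := by
  ext i
  fin_cases i <;> simp

/-- Derivative of the coordinate function `x ↦ x j`. -/
private theorem hasFDerivAt_coord (j : Fin 3) (x : EuclideanSpace ℝ (Fin 3)) :
    HasFDerivAt (fun y : EuclideanSpace ℝ (Fin 3) => y j) (EuclideanSpace.proj j : EuclideanSpace ℝ (Fin 3) →L[ℝ] ℝ) x :=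
  (EuclideanSpace.proj j : EuclideanSpace ℝ (Fin 3) →L[ℝ] ℝ).hasFDerivAt

/-- Derivative of `x ↦ 2π x j`. -/
private theorem hasFDerivAt_scaled_coord (j : Fin 3) (x : EuclideanSpace ℝ (Fin 3)) :
    HasFDerivAt (fun y : EuclideanSpace ℝ (Fin 3) => 2 * π * y j) ((2 * π) • (EuclideanSpace.proj j : EuclideanSpace ℝ (Fin 3) →L[ℝ] ℝ)) x :=
  (hasFDerivAt_coord j x).const_mul (2 * π)

/-- The Jacobian `∂ⱼ uᵢ` of the datum: row `j` = direction, column `i` = component. -/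
def jac (x : EuclideanSpace ℝ (Fin 3)) : Fin 3 → Fin 3 → ℝ :=
  ![![0, -((2 * π) ^ 2 * sin (2 * π * x 0)), (2 * π) ^ 2 * cos (2 * π * x 0)],
    ![(2 * π) ^ 2 * cos (2 * π * x 1), 0, -((2 * π) ^ 2 * sin (2 * π * x 1))],
    ![-((2 * π) ^ 2 * sin (2 * π * x 2)), (2 * π) ^ 2 * cos (2 * π * x 2), 0]]

/-- The Fréchet derivative of the datum, written out through the Jacobian entries `jac`. -/
private theorem hasFDerivAt_datum (x : EuclideanSpace ℝ (Fin 3)) :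
    HasFDerivAt datum
      ((((2 * π) • (cos (2 * π * x 1) • ((2 * π) • (EuclideanSpace.proj (1 : Fin 3) : EuclideanSpace ℝ (Fin 3) →L[ℝ] ℝ)))) +
          ((2 * π) • (-sin (2 * π * x 2) • ((2 * π) • (EuclideanSpace.proj (2 : Fin 3) : EuclideanSpace ℝ (Fin 3) →L[ℝ] ℝ))))).smulRight (EuclideanSpace.single (0 : Fin 3) (1 : ℝ)) +
        (((2 * π) • (cos (2 * π * x 2) • ((2 * π) • (EuclideanSpace.proj (2 : Fin 3) : EuclideanSpace ℝ (Fin 3) →L[ℝ] ℝ)))) +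
          ((2 * π) • (-sin (2 * π * x 0) • ((2 * π) • (EuclideanSpace.proj (0 : Fin 3) : EuclideanSpace ℝ (Fin 3) →L[ℝ] ℝ))))).smulRight (EuclideanSpace.single (1 : Fin 3) (1 : ℝ)) +
        (((2 * π) • (cos (2 * π * x 0) • ((2 * π) • (EuclideanSpace.proj (0 : Fin 3) : EuclideanSpace ℝ (Fin 3) →L[ℝ] ℝ)))) +
          ((2 * π) • (-sin (2 * π * x 1) • ((2 * π) • (EuclideanSpace.proj (1 : Fin 3) : EuclideanSpace ℝ (Fin 3) →L[ℝ] ℝ))))).smulRight (EuclideanSpace.single (2 : Fin 3) (1 : ℝ))) x := by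
  rw [show datum = _ from funext datum_eq]
  have h0 := (((hasFDerivAt_scaled_coord 1 x).sin.const_mul (2 * π)).add
    ((hasFDerivAt_scaled_coord 2 x).cos.const_mul (2 * π))).smul_const (EuclideanSpace.single (0 : Fin 3) (1 : ℝ))
  have h1 := (((hasFDerivAt_scaled_coord 2 x).sin.const_mul (2 * π)).add
    ((hasFDerivAt_scaled_coord 0 x).cos.const_mul (2 * π))).smul_const (EuclideanSpace.single (1 : Fin 3) (1 : ℝ))
  have h2 := (((hasFDerivAt_scaled_coord 0 x).sin.const_mul (2 * π)).add
    ((hasFDerivAt_scaled_coord 1 x).cos.const_mul (2 * π))).smul_const (EuclideanSpace.single (2 : Fin 3) (1 : ℝ))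
  exact (h0.add h1).add h2

/-- The datum is smooth. -/
theorem contDiff_datum {n : WithTop ℕ∞} : ContDiff ℝ n datum := by
  have hc : ∀ j : Fin 3, ContDiff ℝ n (fun y : EuclideanSpace ℝ (Fin 3) => 2 * π * y j) := fun j =>
    contDiff_const.mul (EuclideanSpace.proj j : EuclideanSpace ℝ (Fin 3) →L[ℝ] ℝ).contDiff
  rw [show datum = _ from funext datum_eq]
  exact ((((contDiff_const.mul (hc 1).sin).add (contDiff_const.mul (hc 2).cos)).smul
      contDiff_const).add
    (((contDiff_const.mul (hc 2).sin).add (contDiff_const.mul (hc 0).cos)).smul contDiff_const)).add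
    (((contDiff_const.mul (hc 0).sin).add (contDiff_const.mul (hc 1).cos)).smul contDiff_const)

/-- The datum is differentiable. -/
theorem differentiable_datum : Differentiable ℝ datum := fun x =>
  (hasFDerivAt_datum x).differentiableAt

/-- `∂ⱼ uᵢ` of the datum in coordinates. -/
theorem fderiv_datum_single (x : EuclideanSpace ℝ (Fin 3)) (j i : Fin 3) :
    fderiv ℝ datum x (EuclideanSpace.single (j : Fin 3) (1 : ℝ)) i = jac x j i := by
  rw [(hasFDerivAt_datum x).fderiv]
  fin_cases j <;> fin_cases i <;> simp [jac, mul_comm] <;> ring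

/-- The directional derivative `(𝟙·∇)u⁰ = ∂₁u⁰ + ∂₂u⁰ + ∂₃u⁰` in coordinates. -/
theorem fderiv_datum_ones (x : EuclideanSpace ℝ (Fin 3)) (i : Fin 3) :
    fderiv ℝ datum x ones i = jac x 0 i + jac x 1 i + jac x 2 i := by
  rw [ones_eq, map_add, map_add, PiLp.add_apply, PiLp.add_apply, fderiv_datum_single,
    fderiv_datum_single, fderiv_datum_single]

/-- Component `0` of the directional derivative `(𝟙·∇)u⁰`. -/
@[simp] theorem fderiv_datum_ones_zero (x : EuclideanSpace ℝ (Fin 3)) :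
    fderiv ℝ datum x ones 0 = (2 * π) ^ 2 * cos (2 * π * x 1) - (2 * π) ^ 2 * sin (2 * π * x 2) := by
  rw [fderiv_datum_ones]; simp [jac]; ring

/-- Component `1` of the directional derivative `(𝟙·∇)u⁰`. -/
@[simp] theorem fderiv_datum_ones_one (x : EuclideanSpace ℝ (Fin 3)) :
    fderiv ℝ datum x ones 1 = (2 * π) ^ 2 * cos (2 * π * x 2) - (2 * π) ^ 2 * sin (2 * π * x 0) := by
  rw [fderiv_datum_ones]; simp [jac]; ring

/-- Component `2` of the directional derivative `(𝟙·∇)u⁰`. -/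
@[simp] theorem fderiv_datum_ones_two (x : EuclideanSpace ℝ (Fin 3)) :
    fderiv ℝ datum x ones 2 = (2 * π) ^ 2 * cos (2 * π * x 0) - (2 * π) ^ 2 * sin (2 * π * x 1) := by
  rw [fderiv_datum_ones]; simp [jac]; ring

/-- The datum is divergence free. -/
theorem isDivFree_datum : VectorCalculus.IsDivFree datum := fun x => by
  rw [VectorCalculus.divergence, trace_eq_sum_coord, Fin.sum_univ_three,
    fderiv_datum_single, fderiv_datum_single, fderiv_datum_single]
  simp [jac]

/-- The datum is a STRONG Beltrami field with constant coefficient `−2π`: `curl u⁰ = −2π u⁰`. -/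
theorem curl_datum (x : EuclideanSpace ℝ (Fin 3)) : curl datum x = (-(2 * π)) • datum x := by
  rw [curl_eq_curlCLM, curlCLM_apply]
  simp only [fderiv_datum_single]
  ext i
  fin_cases i <;> simp [jac] <;> ring

/-- The datum is a strong Beltrami field with constant proportionality factor `−2π`. -/
theorem isBeltrami_datum : IsBeltrami datum fun _ => -(2 * π) := fun x => curl_datum x

/-- The datum is `ℤ³`-periodic. -/
theorem isLatticePeriodic_datum : IsLatticePeriodic datum := by
  intro j x
  ext i
  fin_cases j <;> fin_cases i <;>
    simp [datum, mul_add, sin_add, cos_add]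

/-- Beltrami: `(u⁰·∇)u⁰ = ∇(½|u⁰|²)`. -/
theorem convect_datum (x : EuclideanSpace ℝ (Fin 3)) :
    convect datum datum x = gradient (fun y => ‖datum y‖ ^ 2 / 2) x :=
  isBeltrami_datum.convect_eq_gradient (differentiable_datum x)

/-- Strong Beltrami + divergence free: `Δu⁰ = −(2π)² u⁰`. -/
theorem laplacian_datum (x : EuclideanSpace ℝ (Fin 3)) : (Δ datum) x = (-((2 * π) ^ 2)) • datum x := by
  rw [laplacian_eq_of_strongBeltrami isBeltrami_datum (contDiff_infty.1 contDiff_datum 2)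
    isDivFree_datum x, neg_sq]

/-! ### The gauge `g(t) = ct²/(2(a−t))` of Theorem 2.3 (p. 4) -/

/-- The gauge of Theorem 2.3 (p. 4) unfolded: `g(t) = ct²/(2(a−t))`. -/
theorem blowupGauge_eq (c a : ℝ) : blowupGauge c a = fun t => c * t ^ 2 / (2 * (a - t)) := rfl

/-- `g′(t) = c t (2a − t)/(2(a − t)²)` for `t ≠ a`. -/
theorem hasDerivAt_blowupGauge' (c a : ℝ) {t : ℝ} (ht : t ≠ a) :
    HasDerivAt (blowupGauge c a) (c * t * (2 * a - t) / (2 * (a - t) ^ 2)) t := by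
  have h1 : HasDerivAt (fun s : ℝ => c * s ^ 2) (c * (2 * t)) t := by
    simpa using (hasDerivAt_pow 2 t).const_mul c
  have h2 : HasDerivAt (fun s : ℝ => 2 * (a - s)) (-2) t := by
    simpa using ((hasDerivAt_const t a).sub (hasDerivAt_id t)).const_mul (2 : ℝ)
  have hne : 2 * (a - t) ≠ 0 := by
    intro h; apply ht; linarith
  have h3 : HasDerivAt (fun s : ℝ => c * s ^ 2 / (2 * (a - s))) _ t := h1.fun_div h2 hne
  have hne' : a - t ≠ 0 := sub_ne_zero.2 (Ne.symm ht)
  rw [blowupGauge_eq]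
  convert h3 using 1
  field_simp
  ring

/-- `g′(a/2) = 3c/2` (for `a ≠ 0`). -/
theorem deriv_blowupGauge_half (c : ℝ) {a : ℝ} (ha : a ≠ 0) :
    deriv (blowupGauge c a) (a / 2) = 3 * c / 2 := by
  have hne : a / 2 ≠ a := by
    intro h; apply ha; linarith
  rw [(hasDerivAt_blowupGauge' c a hne).deriv]
  field_simp
  ring

/-- `g′` is smooth on `t < a`. -/
theorem contDiffOn_deriv_blowupGauge (c a : ℝ) :
    ContDiffOn ℝ ∞ (deriv (blowupGauge c a)) (Iio a) :=
  ((contDiffOn_infty_iff_deriv_of_isOpen isOpen_Iio).1 (contDiffOn_blowupGauge c a)).2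

/-- `g″` is smooth on `t < a`. -/
theorem contDiffOn_deriv_deriv_blowupGauge (c a : ℝ) :
    ContDiffOn ℝ ∞ (deriv (deriv (blowupGauge c a))) (Iio a) :=
  ((contDiffOn_infty_iff_deriv_of_isOpen isOpen_Iio).1 (contDiffOn_deriv_blowupGauge c a)).2

/-- The gauge is differentiable at every `t < a`. -/
theorem differentiableAt_blowupGauge (c a : ℝ) {t : ℝ} (ht : t < a) :
    DifferentiableAt ℝ (blowupGauge c a) t :=
  ((contDiffOn_blowupGauge c a).differentiableOn (by simp)).differentiableAt (Iio_mem_nhds ht)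

/-- `g′` is differentiable at every `t < a`. -/
theorem differentiableAt_deriv_blowupGauge (c a : ℝ) {t : ℝ} (ht : t < a) :
    DifferentiableAt ℝ (deriv (blowupGauge c a)) t :=
  ((contDiffOn_deriv_blowupGauge c a).differentiableOn (by simp)).differentiableAt (Iio_mem_nhds ht)

/-! ### The phase identity behind the second solution -/

/-- `cos 2θ` and `sin 2θ` for `θ = arctan(κ/β)`. -/
theorem cos_two_mul_arctan_div {β : ℝ} (hβ : β ≠ 0) (κ : ℝ) :
    cos (2 * arctan (κ / β)) = (β ^ 2 - κ ^ 2) / (β ^ 2 + κ ^ 2) := by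
  rw [cos_two_mul, cos_sq_arctan]
  have h1 : (1 : ℝ) + (κ / β) ^ 2 ≠ 0 := by positivity
  have h2 : β ^ 2 + κ ^ 2 ≠ 0 := by positivity
  field_simp
  ring

/-- `sin (2 arctan (κ/β)) = 2βκ/(β² + κ²)` for `β ≠ 0`. -/
theorem sin_two_mul_arctan_div {β : ℝ} (hβ : β ≠ 0) (κ : ℝ) :
    sin (2 * arctan (κ / β)) = 2 * β * κ / (β ^ 2 + κ ^ 2) := by
  rw [sin_two_mul, sin_arctan, cos_arctan]
  have h0 : (0 : ℝ) < 1 + (κ / β) ^ 2 := by positivity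
  have hs : √(1 + (κ / β) ^ 2) ^ 2 = 1 + (κ / β) ^ 2 := sq_sqrt h0.le
  have h2 : β ^ 2 + κ ^ 2 ≠ 0 := by positivity
  calc 2 * (κ / β / √(1 + (κ / β) ^ 2)) * (1 / √(1 + (κ / β) ^ 2))
      = 2 * (κ / β) / (√(1 + (κ / β) ^ 2) ^ 2) := by ring
    _ = 2 * (κ / β) / (1 + (κ / β) ^ 2) := by rw [hs]
    _ = 2 * β * κ / (β ^ 2 + κ ^ 2) := by
      field_simp

/-- `β sin(A − 2θ) + κ cos(A − 2θ) = β sin A − κ cos A` for `θ = arctan(κ/β)`. -/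
theorem phase_sin {β : ℝ} (hβ : β ≠ 0) (κ A : ℝ) :
    β * sin (A - 2 * arctan (κ / β)) + κ * cos (A - 2 * arctan (κ / β)) =
      β * sin A - κ * cos A := by
  rw [sin_sub, cos_sub, cos_two_mul_arctan_div hβ, sin_two_mul_arctan_div hβ]
  have h2 : β ^ 2 + κ ^ 2 ≠ 0 := by positivity
  field_simp
  ring

/-- `β cos(B − 2θ) − κ sin(B − 2θ) = β cos B + κ sin B` for `θ = arctan(κ/β)`. -/
theorem phase_cos {β : ℝ} (hβ : β ≠ 0) (κ B : ℝ) :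
    β * cos (B - 2 * arctan (κ / β)) - κ * sin (B - 2 * arctan (κ / β)) =
      β * cos B + κ * sin B := by
  rw [sin_sub, cos_sub, cos_two_mul_arctan_div hβ, sin_two_mul_arctan_div hβ]
  have h2 : β ^ 2 + κ ^ 2 ≠ 0 := by positivity
  field_simp
  ring

/-- One component of the key identity. -/
theorem phase_component {β : ℝ} (hβ : β ≠ 0) (K A B : ℝ) :
    β * (2 * π * sin (A - 2 * arctan (2 * π * K / β)) + 2 * π * cos (B - 2 * arctan (2 * π * K / β))) +
        K * ((2 * π) ^ 2 * cos (A - 2 * arctan (2 * π * K / β)) -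
          (2 * π) ^ 2 * sin (B - 2 * arctan (2 * π * K / β))) =
      β * (2 * π * sin A + 2 * π * cos B) - K * ((2 * π) ^ 2 * cos A - (2 * π) ^ 2 * sin B) := by
  have h1 := phase_sin hβ (2 * π * K) A
  have h2 := phase_cos hβ (2 * π * K) B
  linear_combination (2 * π) * h1 + (2 * π) * h2

/-- **Key identity.** With `h = G − arctan(2πK/β)/π`:
`β u⁰(y + h𝟙) + K (𝟙·∇)u⁰(y + h𝟙) = β u⁰(y + G𝟙) − K (𝟙·∇)u⁰(y + G𝟙)`. -/
theorem key_identity {β : ℝ} (hβ : β ≠ 0) (G K : ℝ) (y : EuclideanSpace ℝ (Fin 3)) :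
    β • datum (y + (G - arctan (2 * π * K / β) / π) • ones) +
        K • fderiv ℝ datum (y + (G - arctan (2 * π * K / β) / π) • ones) ones =
      β • datum (y + G • ones) - K • fderiv ℝ datum (y + G • ones) ones := by
  have hθ : ∀ s : ℝ, 2 * π * (s + (G - arctan (2 * π * K / β) / π)) =
      2 * π * (s + G) - 2 * arctan (2 * π * K / β) := fun s => by
    field_simp
    ring
  ext i
  fin_cases i <;> simp [hθ] <;> exact phase_component hβ K _ _

/-! ### The `g ≡ 0` member of (2.1): Clay (D)'s conclusion fails at the exhibited data -/

/-- The exactly decaying viscous continuation `u(t,x) = e^{−4π²νt} u⁰(x)` (the `g ≡ 0` member of the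
paper's family (2.1), p. 2–3). -/
def decayVelocity (ν : ℝ) : ℝ → EuclideanSpace ℝ (Fin 3) → EuclideanSpace ℝ (Fin 3) := strongBeltramiVelocity ν (-(2 * π)) datum

/-- Its Bernoulli pressure `p(t,x) = −½ e^{−8π²νt} |u⁰(x)|²` (periodic in `x`). -/
def decayPressure (ν : ℝ) : ℝ → EuclideanSpace ℝ (Fin 3) → ℝ := strongBeltramiPressure ν (-(2 * π)) datum

/-- Exact viscous decay of `u⁰` (the `g ≡ 0` member of (2.1)) is a classical solution on every time set, with zero force. -/
theorem isClassicalNSSolutionOn_decay (ν : ℝ) :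
    IsClassicalNSSolutionOn univ ν 0 (decayVelocity ν) (decayPressure ν) :=
  isClassicalNSSolutionOn_strongBeltrami ν isBeltrami_datum contDiff_datum isDivFree_datum

/-- The decaying solution has datum `initialField`. -/
theorem decayVelocity_zero (ν : ℝ) : decayVelocity ν 0 = initialField := by
  rw [initialField_eq_datum]; exact strongBeltramiVelocity_zero ν _ datum

/-- Every time slice of the decaying velocity is `ℤ³`-periodic. -/
theorem isLatticePeriodic_decayVelocity (ν t : ℝ) : IsLatticePeriodic (decayVelocity ν t) := by
  intro j x
  simp [decayVelocity, strongBeltramiVelocity, isLatticePeriodic_datum j x]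

/-- Every time slice of the decaying pressure is `ℤ³`-periodic. -/
theorem isLatticePeriodic_decayPressure (ν t : ℝ) : IsLatticePeriodic (decayPressure ν t) := by
  intro j x
  simp [decayPressure, strongBeltramiPressure, isLatticePeriodic_datum j x]

/-- For the datum `u⁰` and the force `f ≡ 0` there IS a global smooth solution with `u(·,t)` AND
`p(·,t)` periodic, for every viscosity. -/
theorem exists_globalPeriodicSolution (ν : ℝ) :
    ∃ u p, IsGlobalPeriodicSolution ν 0 initialField u p ∧ ∀ t, 0 ≤ t → IsLatticePeriodic (p t) := by
  have hcl := (isClassicalNSSolutionOn_decay ν).mono (subset_univ (Ici (0 : ℝ))) (uniqueDiffOn_Ici 0)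
  have h := (isNavierStokesSolution_and_smooth_iff (ν := ν) (f := 0) (u₀ := initialField)
    (u := decayVelocity ν) (p := decayPressure ν)).2 ⟨hcl, decayVelocity_zero ν⟩
  exact ⟨decayVelocity ν, decayPressure ν, ⟨h.2.1, h.2.2, h.1,
    fun t _ => isLatticePeriodic_decayVelocity ν t⟩, fun t _ => isLatticePeriodic_decayPressure ν t⟩

end Summit.NavierStokesRegularity.NavierStokesRegularity.Theorems.Jormakka2010
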